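import Literature.Probability.LatticeModels.IsingCriticalBetaConnectiveConstant
import Literature.Probability.RandomPlanarGeometry.SAWFiniteMemoryZ3KernelSymmK10
import Literature.ComputerArithmetic.DeDinechinLauterMullerTorres2013.TinyArguments
import HarnessLib

/-!
# `β_c(ℤ³) > artanh(1/4.7599) = 0.21326…` for the nearest-neighbour Ising model — KERNEL tier (standard axioms)

Topic `Literature/Probability/LatticeModels`. Theorem-only file (no definition, no named fact, no sorry), the standard-axiom
twin of `IsingCriticalBetaCubicMemTen.lean`: there the input `μ(ℤ³) ≤ 4.76` is one `native_decide` (tier CHECKED-native); here the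
input is the KERNEL-checked symmetry-reduced memory-10 Pönitz–Tittmann certificate `SAW.Zd.FiniteMemory3.connectiveConstant_three_le_47599`
(`μ(ℤ³) ≤ 4.7599`, `SAWFiniteMemoryZ3KernelSymmK10.lean`, axioms `propext`/`Classical.choice`/`Quot.sound`). Fisher's inequality
in canonical form (`lt_criticalBeta_of_le_of_mul_tanh_lt_one`: `μ(d) ≤ μ̄`, `μ̄·tanh β < 1 ⇒ β < β_c(d)`) with `μ̄ = 4.7599` gives

* `lt_criticalBeta_three_of_tanh_lt_inv_47599` — **`tanh β < 1/4.7599 ⇒ β < β_c(3)`**, i.e. `β_c(ℤ³) ≥ artanh(1/4.7599) = 0.213265…`;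
* `criticalBeta_three_gt_21_std` — `0.21 < β_c(ℤ³)` with standard axioms (statement-identical twin of the CHECKED-native
  `criticalBeta_three_gt_21`);
* `criticalBeta_three_gt_0213` — **`0.213 < β_c(ℤ³)`** (`tanh 0.213 ≤ 0.20984 < 1/4.7599 = 0.21008…`; the numerical value is
  `β_c(ℤ³) ≈ 0.22165`).

References: M. E. Fisher, Phys. Rev. 162 (1967) 480 [Fisher1967]; A. Pönitz, P. Tittmann, Electron. J. Combin. 7 (2000) R21,
§3 and Table 2 (`d = 3`, `k = 10`: `4.7599`) [PonitzTittmann2000].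
-/

noncomputable section

namespace Literature.Probability.LatticeModels

open Literature.Probability.RandomPlanarGeometry.SAW.Zd (connectiveConstant)
open Literature.Probability.RandomPlanarGeometry.SAW.Zd.FiniteMemory3 (connectiveConstant_three_le_47599)

/-- **`tanh β < 1/4.7599 ⇒ β < β_c(ℤ³)`** (`β ≥ 0`): Fisher's `tanh β_c ≥ 1/μ` with the KERNEL-checked `μ(ℤ³) ≤ 4.7599`; so
`β_c(ℤ³) ≥ artanh(1/4.7599) = 0.213265…`, standard axioms.
[cite: Fisher1967, Phys. Rev. 162 (1967) 480 (tanh(J/kT_c) ≥ 1/μ); PonitzTittmann2000, Table 2 (d = 3, k = 10)] -/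
theorem lt_criticalBeta_three_of_tanh_lt_inv_47599 {β : ℝ} (hβ : 0 ≤ β) (h : Real.tanh β < 1 / 4.7599) :
    β < criticalBeta 3 := by
  refine lt_criticalBeta_of_le_of_mul_tanh_lt_one (d := 3) (by norm_num) hβ connectiveConstant_three_le_47599 ?_
  have h' : 4.7599 * Real.tanh β < 4.7599 * (1 / 4.7599) := mul_lt_mul_of_pos_left h (by norm_num)
  linarith

/-- `β = 21/100 < β_c(ℤ³)` with STANDARD axioms (`tanh 0.21 ≤ 0.20697 < 1/4.7599`); the statement-identical
`criticalBeta_three_gt_21` of `IsingCriticalBetaCubicMemTen.lean` is tier CHECKED-native.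
[cite: Fisher1967, Phys. Rev. 162 (1967) 480; PonitzTittmann2000, Table 2 (d = 3, k = 10)] -/
theorem criticalBeta_three_gt_21_std : (21 / 100 : ℝ) < criticalBeta 3 := by
  refine lt_criticalBeta_three_of_tanh_lt_inv_47599 (by norm_num) ?_
  have hp : Real.tanh (21 / 100 : ℝ) ≤ 21 / 100 - (21 / 100 : ℝ) ^ 3 / 3 + 2 / 15 * (21 / 100 : ℝ) ^ 5 :=
    (Literature.ComputerArithmetic.DeDinechinLauterMullerTorres2013.tanh_quintic_bounds (by norm_num) (by norm_num)).2
  exact hp.trans_lt (by norm_num)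

/-- **`β = 0.213 < β_c(ℤ³)`**, standard axioms (`tanh 0.213 ≤ 0.213 − 0.213³/3 + (2/15)·0.213⁵ = 0.209837… < 1/4.7599 = 0.210088…`);
the best decimal the memory-10 bound supports at three places (`artanh(1/4.7599) = 0.21326…`).
[cite: Fisher1967, Phys. Rev. 162 (1967) 480; PonitzTittmann2000, Table 2 (d = 3, k = 10)] -/
theorem criticalBeta_three_gt_0213 : (213 / 1000 : ℝ) < criticalBeta 3 := by
  refine lt_criticalBeta_three_of_tanh_lt_inv_47599 (by norm_num) ?_
  have hp : Real.tanh (213 / 1000 : ℝ) ≤ 213 / 1000 - (213 / 1000 : ℝ) ^ 3 / 3 + 2 / 15 * (213 / 1000 : ℝ) ^ 5 :=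
    (Literature.ComputerArithmetic.DeDinechinLauterMullerTorres2013.tanh_quintic_bounds (by norm_num) (by norm_num)).2
  exact hp.trans_lt (by norm_num)

end Literature.Probability.LatticeModels

end
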